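import Literature.MathematicalPhysics.KineticTheory.HardSphereEuler
import Literature.Analysis.FluidPDE.HardSphereTorusMeasure
import Summits.AtomisticToContinuum.HydrodynamicLimit.Theorems.AntiMazurCoboundariesKineticWindowGronwallCollarLocalityAE
import HarnessLib

/-!
# A collision at time zero is a null event for the local Gibbs law

Helper file of the lead prover for the registered stub `stub_timeZeroNull` (S5) of the line
`KineticSlabSketch` of the crux `JParityClosure.OddContactSymmetry`
(stmt-AtomisticToContinuum-17722).  The line decomposes the crux's collision statistic over the
CLOSED window `[0, τ]` into half-open kinetic slabs; the closed and the half-open window differ only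
by a collision exactly at time `0`, and the composition discards the set of initial data with such
a collision together with the bad set `Φ.goodᶜ` of the hard-sphere flow `Φ`.  This file shows that
the discarded set is null for the local Gibbs law `localGibbsLaw σ a₀ u₀ θ₀ N Φ`:

* the law is `particleLaw Φ (canonicalDensity …) = (liouville …).withDensity _`
  (`particleLaw_eq`), hence absolutely continuous with respect to the Liouville measure
  (the landed `KineticWindowGronwallCollarLocality.localGibbsLaw_absolutelyContinuous`), which is a
  restriction of Lebesgue measure (`liouville_eq`, `Measure.restrict_le_self`);
* on the good set `Φ_0 = id` (`HardSphereFlow.flow_zero`), so a good datum whose orbit has a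
  collision at time `0` is itself a contact configuration of some pair `i ≠ j`, and contact sets of
  the torus are Lebesgue-null for a nonzero diameter (`volume_contactSet`, `hsDiameter_pos`);
* the bad set is Liouville-null by definition of a hard-sphere flow
  (`HardSphereFlow.measure_compl_good`).

## References

* I. Gallagher, L. Saint-Raymond, B. Texier, *From Newton to Boltzmann: hard spheres and
  short-range potentials*, EMS (2013), §4.1 (contact sets are boundary pieces of the hard-sphere
  domain, of Liouville measure zero; Prop. 4.1.1, the conull good set of the flow).
-/

noncomputable section

open Set MeasureTheory Filter
open Literature.Analysis.FluidPDE Literature.MathematicalPhysics.KineticTheory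

namespace Summit.AtomisticToContinuum.HydrodynamicLimit.Theorems.OddContactSymmetryKineticSlab

/-- The Liouville measure of the torus phase space is absolutely continuous with respect to
Lebesgue measure (it is a restriction of it). [folklore] -/
theorem liouville_absolutelyContinuous_volume (N : ℕ) (ε : ℝ) :
    liouville (Torus.geometry (Fin 3)) N ε ≪ (volume : Measure (Config N (Fin 3) T3)) := by
  rw [liouville_eq]
  exact Measure.absolutelyContinuous_of_le Measure.restrict_le_self

/-- On the good set, a collision at time `0` of the orbit means that the initial datum itself is a
contact configuration of some pair `i ≠ j` (`Φ_0 = id` on the good set). [folklore] -/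
theorem setOf_zero_mem_collisionTimes_subset {ε : ℝ} {N : ℕ}
    (Φ : HardSphereFlow (Torus.geometry (Fin 3)) ε N) :
    {z | (0 : ℝ) ∈ collisionTimes (Torus.geometry (Fin 3)) ε (fun t => Φ.flow t z)} ⊆
      (⋃ i : Fin N, ⋃ j : Fin N, ⋃ (_ : i ≠ j), contactSet (Torus.geometry (Fin 3)) N ε i j) ∪
        Φ.goodᶜ := by
  intro z (hz : (0 : ℝ) ∈ collisionTimes (Torus.geometry (Fin 3)) ε fun t => Φ.flow t z)
  by_cases hg : z ∈ Φ.good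
  · obtain ⟨i, j, hij, hmem⟩ := (mem_collisionTimes (γ := fun t => Φ.flow t z) (t := 0)).1 hz
    have hmem' : Φ.flow 0 z ∈ contactSet (Torus.geometry (Fin 3)) N ε i j := hmem
    rw [Φ.flow_zero z hg] at hmem'
    exact Or.inl (mem_iUnion.2 ⟨i, mem_iUnion.2 ⟨j, mem_iUnion.2 ⟨hij, hmem'⟩⟩⟩)
  · exact Or.inr hg

/-- **S5 `stub_timeZeroNull` — a collision at time `0` is a null event.**  Under any law of the form
`localGibbsLaw` (absolutely continuous with respect to the Liouville measure) the initial data whose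
orbit has a collision at time `0`, together with the bad set, are null: on the good set `Φ_0 = id`,
so such a datum is a contact configuration, and contact sets are Lebesgue-null
(`volume_contactSet`). [folklore] -/
theorem stub_timeZeroNull {σ : ℝ} (hσ : 0 < σ) (a₀ θ₀ : T3 → ℝ) (u₀ : T3 → V3) (N : ℕ)
    (Φ : HardSphereFlow (Torus.geometry (Fin 3)) (hsDiameter σ N) (N + 1)) :
    localGibbsLaw σ a₀ u₀ θ₀ N Φ
      ({z | (0 : ℝ) ∈ collisionTimes (Torus.geometry (Fin 3)) (hsDiameter σ N) (fun t => Φ.flow t z)} ∪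
        Φ.goodᶜ) = 0 := by
  have hac := KineticWindowGronwallCollarLocality.localGibbsLaw_absolutelyContinuous σ a₀ θ₀ u₀ N Φ
  have hvol := liouville_absolutelyContinuous_volume (N + 1) (hsDiameter σ N)
  have hbad : localGibbsLaw σ a₀ u₀ θ₀ N Φ Φ.goodᶜ = 0 := hac Φ.measure_compl_good
  refine measure_union_null ?_ hbad
  refine measure_mono_null (setOf_zero_mem_collisionTimes_subset Φ) (measure_union_null ?_ hbad)
  refine measure_iUnion_null_iff.2 fun i => measure_iUnion_null_iff.2 fun j =>
    measure_iUnion_null_iff.2 fun hij => ?_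
  exact hac (hvol (volume_contactSet (hsDiameter_pos hσ N).ne' hij))

end Summit.AtomisticToContinuum.HydrodynamicLimit.Theorems.OddContactSymmetryKineticSlab
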